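import Summits.QuantumFields.QCD.Theorems.PauliWegnerSeaChiralGluonicCompletionRetypeGoldstoneSkeleton
import Summits.QuantumFields.QCD.Theses.GaussianLinkFrames

/-!
# Crux `ChiralGluonicCompletion` (stmt-QuantumFields-17498) — the GLUE of the prepared split
# `GoldstonePinUpgrade → PackageLatticeGap → PackageContinuum → ChiralGluonicCompletion` (line `goldstone_split`, lead c9, 2026-08-17)

The crux-strategist's pass (Cruxes/ChiralGluonicCompletion/STRATEGY-CENSUS.md; registered line
`Cruxes/ChiralGluonicCompletion/Lines/goldstone_split.lean`) re-cuts the crux as typed into three pieces, the first of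
which is WITNESS-FREE (so that none of the pin-shape countermodels p142184 / p144745 / p146141 or the keep-reg
mass-blindness certificate p150170 bears on it):

1. `GoldstonePinUpgrade` — `(∃ reg, Hyp N_f reg) → ∃ reg, HasMassScaling ∧ HasGoldstoneBound ∧ HasAsymptoticScaling ∧ ∀ m > 0, PerMass`
   (the shape of `DiagonalSpine.ChiralTuning`, stmt-17436; supplier-side: `MobilityGapPlus` + `PhaseQuenchedFlavourDecay`);
2. `PackageLatticeGap` — pin-free, ∀-given-regularisation signed lattice gap at every positive tuple from the package;
3. `PackageContinuum` — pin-free, ∀-given-regularisation, gap-conditioned continuum half along ONE subsequence for all tuples.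

This file is the kernel-checked GLUE of that split with the ROUTE DECL as conclusion (registered sub-goal
`chiralGluonicCompletion_of_split`): three lines over the landed two-stub Goldstone skeleton
`chiralGluonicCompletionGoldstone_of_goldstoneStubs` (p143054) — the pin upgrade turns the typed witness into a Goldstone
package witness, the two pin-free package statements are (weakenings of) the two Goldstone stubs, and the completed
witness `reg.restrict φ` is chiral at zero because `HasGoldstoneBound` restricts; NO chirality argument over the given
witness is made anywhere.  Twins for the rfl-equal WilsonMobilityGap / GaussianLinkFrames copies of the crux.
The three antecedents are stated over the landed abbreviations `Hyp`, `PerMass`, `ContinuumBody`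
(`PauliWegnerSeaChiralGluonicCompletionDefs.lean`), hence are `Iff.rfl`-equal to the registered stubs
`stub_goldstonePinUpgrade`, `stub_packageLatticeGap`, `stub_packageContinuum` of the line and to the inlined texts of the
strategist's `children.json`; when the split is executed, the generated glue item is this theorem verbatim.
-/

noncomputable section

namespace Summit.QuantumFields.QCD.Theorems.StronglyChiralSubsequence

open MeasureTheory Filter Topology
open Literature.MathematicalPhysics.QuantumFieldTheory Literature.MathematicalPhysics.QuantumLattice
  Literature.Probability.LatticeModels

/-- **Registered sub-goal `chiralGluonicCompletion_of_split` — the glue of the split.**  If (1) every typed package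
witness class `HypC N_f` contains a GOLDSTONE package witness (witness-free pin upgrade), (2) every AF mass-scaling
regularisation carrying the per-mass package at every positive tuple has a signed all-volume lattice gap at every positive
tuple, and (3) every such gapped regularisation has one subsequence carrying the continuum half (`ContinuumBody`) at every
positive tuple, then `ChiralGluonicCompletion` (PauliWegnerSea copy) holds.  Proof: feed (1)'s Goldstone witness to the
two-stub Goldstone skeleton `chiralGluonicCompletionGoldstone_of_goldstoneStubs` (p143054) with (2), (3) weakened to its
Goldstone-hypothesised stubs. -/
theorem chiralGluonicCompletion_of_split : (∀ Nf : ℕ, Nf = 2 ∨ Nf = 3 → (∃ reg : QCDRegularisation Nf, Hyp Nf reg) → ∃ reg : QCDRegularisation Nf, reg.HasMassScaling ∧ reg.HasGoldstoneBound ∧ (reg.scheme 0 0 0).HasAsymptoticScaling ∧ ∀ m : Fin Nf → ℝ, (∀ f, 0 < m f) → PerMass Nf reg m) → (∀ Nf : ℕ, Nf = 2 ∨ Nf = 3 → ∀ reg : QCDRegularisation Nf, reg.HasMassScaling → (reg.scheme 0 0 0).HasAsymptoticScaling → (∀ m : Fin Nf → ℝ, (∀ f, 0 < m f) → PerMass Nf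 reg m) → ∀ m : Fin Nf → ℝ, (∀ f, 0 < m f) → ∃ Δ > 0, (reg.scheme m 0 0).HasLatticeMassGap Δ) → (∀ Nf : ℕ, Nf = 2 ∨ Nf = 3 → ∀ reg : QCDRegularisation Nf, reg.HasMassScaling → (reg.scheme 0 0 0).HasAsymptoticScaling → (∀ m : Fin Nf → ℝ, (∀ f, 0 < m f) → PerMass Nf reg m) → (∀ m : Fin Nf → ℝ, (∀ f, 0 < m f) → ∃ Δ > 0, (reg.scheme m 0 0).HasLatticeMassGap Δ) → ∃ φ : ℕ → ℕ, ∃ hφ : StrictMono φ, ∀ m : Fin Nf → ℝ, (∀ f, 0 < m f) → ContinuumBody Nf (reg.restrict φ hφ.tendsto_atTop) m) → Summit.QuantumFields.QCD.Theses.PauliWegnerSea.ChiralGluonicCompletion := by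
  intro h₁ h₂ h₃ Nf hNf hC
  exact chiralGluonicCompletionGoldstone_of_goldstoneStubs
    (fun Nf hNf reg hG => h₂ Nf hNf reg hG.1 hG.2.2.1 hG.2.2.2)
    (fun Nf hNf reg hG hgap => h₃ Nf hNf reg hG.1 hG.2.2.1 hG.2.2.2 hgap) Nf hNf (h₁ Nf hNf hC)

/-- The same glue for the WilsonMobilityGap copy of the crux (rfl-equal text, `crux_eq_wilsonMobilityGap`). -/
theorem wilsonMobilityGap_chiralGluonicCompletion_of_split (h₁ : ∀ Nf : ℕ, Nf = 2 ∨ Nf = 3 → (∃ reg : QCDRegularisation Nf, Hyp Nf reg) → ∃ reg : QCDRegularisation Nf, reg.HasMassScaling ∧ reg.HasGoldstoneBound ∧ (reg.scheme 0 0 0).HasAsymptoticScaling ∧ ∀ m : Fin Nf → ℝ, (∀ f, 0 < m f) → PerMass Nf reg m) (h₂ : ∀ Nf : ℕ, Nf = 2 ∨ Nf = 3 → ∀ reg : QCDRegularisation Nf, reg.HasMassScaling → (reg.scheme 0 0 0).HasAsymptoticScaling → (∀ m : Fin Nf → ℝ, (∀ f, 0 < m f) → PerMass Nf reg m) → ∀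 m : Fin Nf → ℝ, (∀ f, 0 < m f) → ∃ Δ > 0, (reg.scheme m 0 0).HasLatticeMassGap Δ) (h₃ : ∀ Nf : ℕ, Nf = 2 ∨ Nf = 3 → ∀ reg : QCDRegularisation Nf, reg.HasMassScaling → (reg.scheme 0 0 0).HasAsymptoticScaling → (∀ m : Fin Nf → ℝ, (∀ f, 0 < m f) → PerMass Nf reg m) → (∀ m : Fin Nf → ℝ, (∀ f, 0 < m f) → ∃ Δ > 0, (reg.scheme m 0 0).HasLatticeMassGap Δ) → ∃ φ : ℕ → ℕ, ∃ hφ : StrictMono φ, ∀ m : Fin Nf → ℝ, (∀ f, 0 < m f) → ContinuumBody Nf (reg.restrict φ hφ.tendsto_atTop) m) : Summit.QuantumFields.QCD.Theses.WilsonMobilityGap.ChiralGluonicCompletion :=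
  chiralGluonicCompletion_of_split h₁ h₂ h₃

/-- The same glue for the GaussianLinkFrames copy of the crux (rfl-equal text). -/
theorem gaussianLinkFrames_chiralGluonicCompletion_of_split (h₁ : ∀ Nf : ℕ, Nf = 2 ∨ Nf = 3 → (∃ reg : QCDRegularisation Nf, Hyp Nf reg) → ∃ reg : QCDRegularisation Nf, reg.HasMassScaling ∧ reg.HasGoldstoneBound ∧ (reg.scheme 0 0 0).HasAsymptoticScaling ∧ ∀ m : Fin Nf → ℝ, (∀ f, 0 < m f) → PerMass Nf reg m) (h₂ : ∀ Nf : ℕ, Nf = 2 ∨ Nf = 3 → ∀ reg : QCDRegularisation Nf, reg.HasMassScaling → (reg.scheme 0 0 0).HasAsymptoticScaling → (∀ m : Fin Nf → ℝ, (∀ f, 0 < m f) → PerMass Nf reg m) → ∀ m : Fin Nf → ℝ, (∀ f, 0 < m f) → ∃ Δ > 0, (reg.scheme m 0 0).HasLatticeMassGap Δ) (h₃ : ∀ Nf : ℕ, Nf = 2 ∨ Nf = 3 → ∀ reg : QCDRegularisation Nf, reg.HasMassScaling → (reg.scheme 0 0 0).HasAsymptoticScaling → (∀ m : Fin Nf →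 ℝ, (∀ f, 0 < m f) → PerMass Nf reg m) → (∀ m : Fin Nf → ℝ, (∀ f, 0 < m f) → ∃ Δ > 0, (reg.scheme m 0 0).HasLatticeMassGap Δ) → ∃ φ : ℕ → ℕ, ∃ hφ : StrictMono φ, ∀ m : Fin Nf → ℝ, (∀ f, 0 < m f) → ContinuumBody Nf (reg.restrict φ hφ.tendsto_atTop) m) : Summit.QuantumFields.QCD.Theses.GaussianLinkFrames.ChiralGluonicCompletion :=
  chiralGluonicCompletion_of_split h₁ h₂ h₃

end Summit.QuantumFields.QCD.Theorems.StronglyChiralSubsequence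

end
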